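import Literature.AnabelianGeometry.EtaleTheta.GalSectCor28iiNodeCloser
import HarnessLib

/-!
# [EtTh] Cor. 2.8 (ii) — BINDER CENSUS of the node closer, made kernel-checkable (proof-only)

Mochizuki, *The étale theta function and its Frobenioid-theoretic manifestations* [EtTh], Publ. RIMS **45**
(2009), Cor. 2.8 (ii) p.268 (PRIMS PDF p.42), proof p.269 l.1–4 ("assertion (ii) follows immediately from
Theorem 1.10, (iii), and the definitions") [cite: MochizukiEtTh2009, Cor 2.8 (ii) p.42]; [GalSect] §4,
Def. 4.1 [cite: MochizukiGalSect2005, Def 4.1 p.33].  abc-iut cell, layer L2, block C / W6 row `EtTh:Cor2.8(ii)`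
(seat abc-iut-w6-d050 gen 4), companion of the NODE CLOSER `GalSectCor28iiNodeCloser.lean` (p441545,
`cor28_ii_of_equivariantFamilies`) and of abc-iut-w5-d062's END-KNIT `GalSectCor28iiEndKnit.lean` (p436362).
PROOF-ONLY: no definitions, no instances, no named facts; nothing of the typer's files is restated.

PURPOSE.  The node closer discharges ROW (B)'s `TemperedCoverData.Cor28_ii` (the four printed cases) modulo
NAMED INPUTS: the stabilisation data `(Δ)`/`(x)` of the list-automorphisms and, per member, a family
`(R, hR, hReq)` of `μ_n`-sub-structures of the canonical integral structures with its equivariance.  This file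
records, as theorems, exactly how much of that input is substantive:

* `Cor28iiData.exists_isSubStructure_canonical`, `Cor28iiData.exists_family_isSubStructure` — under the v2
  law of `Cor28iiData` (13:00Z structure window, G-w5d062-2: each canonical integral structure IS an
  `O_K^×`-structure and `μ_n ≤ O_K^×`) the EXISTENCE half `hR` of the family is AUTOMATIC at every cusp of
  every member: a `μ_n`-structure compatible with the canonical integral structure always exists.  So the
  binder `hR` restricts nothing; the content of the named input is WHICH orbit, i.e. its EQUIVARIANCE — in
  print "the `{±1}`-structure of Theorem 1.10, (iii), determines … [cf. [GalSect] Cor. 4.12] … preserved by `γ`"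
  (the Kummer identification of the cusp torsors with theta-root classes; L2 census v1.4 item D6 / K2 (gen),
  booked «future»).
* `cor28iiAt_of_weakEquivariantFamily` — the member statement `Cor28iiAt S L n 𝒟` follows from a family
  `R` with `hR` and the WEAK equivariance "for every `L`-automorphism `Γ` and cusp `g` there is a cusp `g'`
  with `Γ(D_{z_g}, I_{z_g}) = (D_{z_{g'}}, I_{z_{g'}})` such that the class transport carries `R g` onto
  `R g'`" — with NO stabilisation data at all (the image cusp is part of the input here);
* `cor28iiAt_iff_weakEquivariantFamily` — and conversely (given only that the `L`-automorphisms stabilise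
  `Δ^tp_C`, the `(Δ)` half of the closer's `hstab`), so the typed member statement IS EXACTLY the existence
  of a weakly equivariant family of `μ_n`-sub-structures of the canonical integral structures (w5-d062's
  converse `Cor28iiAt.image_classTransport_eq`, repackaged as an `iff`);
* `cor28_ii_iff_cases` — the node is by definition the conjunction of the four member statements (cases
  `X̲̲`/`μ_{2l}`, `X̲`/`μ₂`, `C̲̲`/`μ_{2l}`, `C̲`/`μ₂` with their Prop. 2.4 lists), so the census applies case by case;
* `stabData_of_conj` — the closer's stabilisation input `(Δ)` + `(x)` HOLDS for every INNER automorphism of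
  `Π^tp_C` (`Δ^tp_C` is normal; `D_C` goes to its conjugate): the named input concerns outer automorphisms
  only ([AbsAnab] Lem. 1.3.8 / [SemiAnbd] Thm. 6.5 (iii) genre, as recorded in p436362/p441545);
* `cor28iiAt_of_not_hasMuL`, `cor28iiAt_of_not_resCharPrimeToL`, `cor28iiAt_of_not_rational` — print's
  "Suppose further that …" clauses are ANTECEDENTS of the typed statement (vacuous truth when one fails).

HONEST FRAMING: [EtTh], [GalSect] are refereed published papers; nothing printed is asserted here — every
family / stabilisation datum is an INPUT; typed ≠ proved; the abc-iut cell takes no side on [IUTchIII]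
Cor. 3.12, on which nothing in this file bears.
-/

noncomputable section

namespace Literature.AnabelianGeometry.EtaleTheta

open scoped Pointwise

namespace ThetaCovers

namespace TemperedCoverData

universe u

variable {l : ℕ} (T : TemperedCoverData.{u} l)

/-! ### The existence half of the family is automatic under the v2 law -/

/-- **Existence is automatic (v2 law).**  At every cusp `g` of the member `S`, for every `n`, there IS a
`μ_n`-structure compatible with the canonical integral structure: the canonical integral structure is an
`O_K^×`-structure (`canonical_isStructure`) and `μ_n ≤ O_K^×` (`mu_le`), so the `μ_n`-orbit of any of its
members will do (ROW (B)'s `TorsorData.exists_isSubStructure`).  Hence the binder `hR` of the node closer is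
never restrictive. [cite: MochizukiGalSect2005, Def 4.1 (iii) p.34] -/
theorem Cor28iiData.exists_isSubStructure_canonical {S : Subgroup T.Gtp} {A : Type u} [Group A]
    (𝒟 : T.Cor28iiData S A) (n : ℕ) (g : T.Gtp) :
    ∃ R : Set (T.cuspPairAt S g).SplittingClass,
      (𝒟.torsor g).IsSubStructure (𝒟.mu n) (𝒟.canonical g) R :=
  (𝒟.torsor g).exists_isSubStructure (𝒟.mu_le n) (𝒟.canonical_isStructure g)

/-- **A family of `μ_n`-sub-structures of the canonical integral structures always exists** (one per cusp,
by choice) — the `R`/`hR` part of the node closer's named input is inhabited at every v2 datum; only its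
equivariance `hReq` carries content. [cite: MochizukiEtTh2009, Cor 2.8 (ii) p.42] -/
theorem Cor28iiData.exists_family_isSubStructure {S : Subgroup T.Gtp} {A : Type u} [Group A]
    (𝒟 : T.Cor28iiData S A) (n : ℕ) :
    ∃ R : ∀ g : T.Gtp, Set (T.cuspPairAt S g).SplittingClass,
      ∀ g, (𝒟.torsor g).IsSubStructure (𝒟.mu n) (𝒟.canonical g) (R g) :=
  ⟨fun g => (𝒟.exists_isSubStructure_canonical T n g).choose,
    fun g => (𝒟.exists_isSubStructure_canonical T n g).choose_spec⟩

/-! ### The member statement is exactly "a weakly equivariant family exists" -/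

/-- **`Cor28iiAt` from a WEAKLY equivariant family, no stabilisation data.**  If `R` is a family of
`μ_n`-sub-structures of the canonical integral structures such that for every `L`-automorphism `Γ` and every
cusp `g` there is a cusp `g'` whose cuspidal pair is the `Γ`-image of that of `g` and onto whose structure the
class transport along `Γ` carries `R g`, then `Cor28iiAt S L n 𝒟` holds ("preserved by `γ`" =
`preservedBy_image_classTransport`, a THEOREM of abc-iut-w5-d062). [cite: MochizukiEtTh2009, Cor 2.8 (ii) p.42] -/
theorem cor28iiAt_of_weakEquivariantFamily (S : Subgroup T.Gtp) (L : List (Subgroup T.Gtp)) (n : ℕ)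
    {A : Type u} [Group A] (𝒟 : T.Cor28iiData S A)
    (R : ∀ g : T.Gtp, Set (T.cuspPairAt S g).SplittingClass)
    (hR : ∀ g, (𝒟.torsor g).IsSubStructure (𝒟.mu n) (𝒟.canonical g) (R g))
    (hweq : ∀ Γ : T.Gtp ≃ₜ* T.Gtp, (∀ S' ∈ L, S'.map Γ.toMulEquiv.toMonoidHom = S') →
      ∀ g, ∃ g', (T.cuspPairAt S g).map Γ = T.cuspPairAt S g' ∧
        ∀ (e : (T.cuspPairAt S g).SplittingClass → (T.cuspPairAt S g').SplittingClass),
          (∀ (S₁ : Subgroup T.Gtp) (hS₁ : S₁ ∈ (T.cuspPairAt S g).splittings),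
            ∃ h', e (GalSect.CuspPair.SplittingClass.mk _ S₁ hS₁) =
              GalSect.CuspPair.SplittingClass.mk _ (S₁.map Γ.toMulEquiv.toMonoidHom) h') →
          R g' = e '' R g) :
    T.Cor28iiAt S L n 𝒟 := by
  intro _ _ _
  refine ⟨R, hR, fun Γ hΓ g => ?_⟩
  obtain ⟨g', hpair, htr⟩ := hweq Γ hΓ g
  obtain ⟨e, he⟩ := GalSect.CuspPair.exists_classTransport Γ hpair
  refine ⟨g', ?_⟩
  rw [htr e he]
  exact GalSect.CuspPair.preservedBy_image_classTransport hpair he (R g)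

/-- **The typed member statement IS the existence of a weakly equivariant family** of `μ_n`-sub-structures
of the canonical integral structures — given only that the `L`-automorphisms stabilise `Δ^tp_C` (the `(Δ)`
half of the node closer's stabilisation input; [AbsAnab] Lem. 1.3.8 genre).  Forward: abc-iut-w5-d062's
`Cor28iiAt.image_classTransport_eq` (p436362); backward: `cor28iiAt_of_weakEquivariantFamily`.  So the node's
named input is exactly its typed content — in print, the family "determined by the `{±1}`-structure of
Theorem 1.10, (iii)" and its being "preserved by `γ`". [cite: MochizukiEtTh2009, Cor 2.8 (ii) p.42] -/
theorem cor28iiAt_iff_weakEquivariantFamily (S : Subgroup T.Gtp) (L : List (Subgroup T.Gtp)) (n : ℕ)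
    {A : Type u} [Group A] (𝒟 : T.Cor28iiData S A)
    (hΔ : ∀ Γ : T.Gtp ≃ₜ* T.Gtp, (∀ S' ∈ L, S'.map Γ.toMulEquiv.toMonoidHom = S') →
      T.DeltaTp.map Γ.toMulEquiv.toMonoidHom = T.DeltaTp) :
    T.Cor28iiAt S L n 𝒟 ↔
      (T.HasMuL → 𝒟.ResCharPrimeToL → (∀ g, T.IsRationalCusp S g) →
        ∃ R : ∀ g : T.Gtp, Set (T.cuspPairAt S g).SplittingClass,
          (∀ g, (𝒟.torsor g).IsSubStructure (𝒟.mu n) (𝒟.canonical g) (R g)) ∧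
          ∀ Γ : T.Gtp ≃ₜ* T.Gtp, (∀ S' ∈ L, S'.map Γ.toMulEquiv.toMonoidHom = S') →
            ∀ g, ∃ g', (T.cuspPairAt S g).map Γ = T.cuspPairAt S g' ∧
              ∀ (e : (T.cuspPairAt S g).SplittingClass → (T.cuspPairAt S g').SplittingClass),
                (∀ (S₁ : Subgroup T.Gtp) (hS₁ : S₁ ∈ (T.cuspPairAt S g).splittings),
                  ∃ h', e (GalSect.CuspPair.SplittingClass.mk _ S₁ hS₁) =
                    GalSect.CuspPair.SplittingClass.mk _ (S₁.map Γ.toMulEquiv.toMonoidHom) h') →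
                R g' = e '' R g) := by
  constructor
  · intro h28 hμ hres hrat
    exact h28.image_classTransport_eq T hμ hres hrat hΔ
  · intro h hμ hres hrat
    obtain ⟨R, hR, hweq⟩ := h hμ hres hrat
    exact T.cor28iiAt_of_weakEquivariantFamily S L n 𝒟 R hR hweq hμ hres hrat

/-- **The node is the conjunction of its four member statements** (cases `X̲̲`/`μ_{2l}` and `C̲̲`/`μ_{2l}` over
the tower list, `X̲`/`μ₂` and `C̲`/`μ₂` over their Prop. 2.4 lists) — by definition of ROW (B)'s `Cor28_ii`; so
`cor28iiAt_iff_weakEquivariantFamily` gives the census of the whole node case by case.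
[cite: MochizukiEtTh2009, Cor 2.8 (ii) p.42] -/
theorem cor28_ii_iff_cases {A : Type u} [Group A]
    (𝒟Xuu : T.Cor28iiData (T.tp T.PiXuu) A) (𝒟Xu : T.Cor28iiData (T.tp T.PiXu) A)
    (𝒟Cuu : T.Cor28iiData (T.tp T.PiCuu) A) (𝒟Cu : T.Cor28iiData (T.tp T.PiCu) A) :
    T.Cor28_ii 𝒟Xuu 𝒟Xu 𝒟Cuu 𝒟Cu ↔
      T.Cor28iiAt (T.tp T.PiXuu) T.tower (2 * l) 𝒟Xuu ∧
      T.Cor28iiAt (T.tp T.PiXu) [T.tp T.PiXu, T.tp T.PiX, T.PiYddtp] 2 𝒟Xu ∧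
      T.Cor28iiAt (T.tp T.PiCuu) T.tower (2 * l) 𝒟Cuu ∧
      T.Cor28iiAt (T.tp T.PiCu) [T.tp T.PiCu, T.tp T.PiXu, T.tp T.PiX, T.PiYddtp] 2 𝒟Cu :=
  Iff.rfl

/-! ### The stabilisation input holds for inner automorphisms -/

/-- **`(Δ)` + `(x)` for INNER automorphisms.**  If the automorphism `Γ` of `Π^tp_C` is conjugation by `c`,
then it stabilises `Δ^tp_C` (a normal subgroup) and carries the cusp decomposition group `D_C` to its
conjugate `c·D_C·c⁻¹` — so the node closer's stabilisation input `hstab` is automatic on inner automorphisms;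
its content is about OUTER automorphisms of `Π^tp_C` ([AbsAnab] Lem. 1.3.8 / [SemiAnbd] Thm. 6.5 (iii)
genre, as recorded in p436362 / p441545). [cite: MochizukiEtTh2009, Cor 2.8 (ii) p.42] -/
theorem stabData_of_conj (c : T.Gtp) (Γ : T.Gtp ≃ₜ* T.Gtp) (hΓ : ∀ x, Γ x = c * x * c⁻¹) :
    T.DeltaTp.map Γ.toMulEquiv.toMonoidHom = T.DeltaTp ∧
      ∃ h : T.Gtp, T.cuspStabC.map Γ.toMulEquiv.toMonoidHom = MulAut.conj h • T.cuspStabC := by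
  have hmap : ∀ H : Subgroup T.Gtp, H.map Γ.toMulEquiv.toMonoidHom = MulAut.conj c • H := by
    intro H
    ext y
    simp only [Subgroup.mem_map, Subgroup.mem_smul_pointwise_iff_exists, MulAut.smul_def,
      MulAut.conj_apply, MulEquiv.toMonoidHom_eq_coe, MonoidHom.coe_coe]
    constructor
    · rintro ⟨x, hx, rfl⟩
      exact ⟨x, hx, (hΓ x).symm⟩
    · rintro ⟨x, hx, rfl⟩
      exact ⟨x, hx, hΓ x⟩
  haveI : (T.DeltaTp).Normal := inferInstanceAs (T.aug.comp T.toHat).ker.Normal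
  refine ⟨?_, c, hmap _⟩
  rw [hmap, GalSect.conj_smul_eq_self_of_normal T.DeltaTp c]

/-! ### Print's "Suppose further that …" clauses are antecedents -/

/-- If `K` does NOT contain a primitive `l`-th root of unity, the typed member statement holds vacuously
(print: "Suppose further … that `K_□` contains a primitive `l`-th root of unity").
[cite: MochizukiEtTh2009, Cor 2.8 (ii) p.42] -/
theorem cor28iiAt_of_not_hasMuL (S : Subgroup T.Gtp) (L : List (Subgroup T.Gtp)) (n : ℕ)
    {A : Type u} [Group A] (𝒟 : T.Cor28iiData S A) (h : ¬ T.HasMuL) : T.Cor28iiAt S L n 𝒟 :=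
  fun hμ => absurd hμ h

/-- If the residue characteristic flag fails, the typed member statement holds vacuously (print: "Suppose
further … that the residue characteristic of `K_□` is prime to `l`"). [cite: MochizukiEtTh2009, Cor 2.8 (ii) p.42] -/
theorem cor28iiAt_of_not_resCharPrimeToL (S : Subgroup T.Gtp) (L : List (Subgroup T.Gtp)) (n : ℕ)
    {A : Type u} [Group A] (𝒟 : T.Cor28iiData S A) (h : ¬ 𝒟.ResCharPrimeToL) : T.Cor28iiAt S L n 𝒟 :=
  fun _ hres => absurd hres h

/-- If some cusp of the member is NOT `K`-rational, the typed member statement holds vacuously (print: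
"Suppose further that the cusps of `X̲_□` are rational over `K_□`"). [cite: MochizukiEtTh2009, Cor 2.8 (ii) p.42] -/
theorem cor28iiAt_of_not_rational (S : Subgroup T.Gtp) (L : List (Subgroup T.Gtp)) (n : ℕ)
    {A : Type u} [Group A] (𝒟 : T.Cor28iiData S A) (h : ∃ g, ¬ T.IsRationalCusp S g) :
    T.Cor28iiAt S L n 𝒟 :=
  fun _ _ hrat => by
    obtain ⟨g, hg⟩ := h
    exact absurd (hrat g) hg

end TemperedCoverData

end ThetaCovers

end Literature.AnabelianGeometry.EtaleTheta

end
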